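/-
Copyright (c) 2026 the pub-hodgecm-mathlib formalisation cell (harness21).  Prover seat hodgecm-mathlib-K2E1-p09 (g6), Track B ∕ K2-LIT, h413 =
`stmt-HodgeConjecture-24833`, ENGINE E1, campaign «EIS-WHITTAKER-3», deal D-W5 «W2₃-fin-S» FILE B of the dealer K2E1-plan (g5) («=» 2026-09-04T08:41:11Z: «THEN FILE B
`K2E1FiniteWhittakerStepSymbolU3Line` (instance) SAME HAND»).
-/
import Summits.HodgeConjecture.HodgeConjecture.Theorems.K2E1FiniteWhittakerStepSymbolU3Tail   -- ★ FILE A ∕ A-TAIL (this seat): the engine and the HEAD `exists_entire_eq_integral_integral_cpow_neg_mul_addChar`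
import HarnessLib

/-!
# K2·E1 — `K2E1FiniteWhittakerStepSymbolU3Line` (D-W5 «W2₃-fin-S», FILE B): THE INSTANCE — THE CORNER KERNEL `h(X,t) = max(1, ‖X‖_E, ‖ι(t)·δ − C(X)‖_E)` OF THE
# `U(2,1)` BIG CELL AT A NON-SPLIT FINITE PLACE SATISFIES THE LETTERS (B)(R)(T)(H): ITS WHITTAKER `S`-FACTOR IS ONE ENTIRE FUNCTION, SUPPORTED ON `ξ ∈ 𝔭^{m−a}`

Track B ∕ K2-LIT, crux h413 = `stmt-HodgeConjecture-24833`, route of record `HCCMUnconditional`; cell `hodgecm-mathlib`, squad K2, ENGINE E1 (campaign «EIS-WHITTAKER-3», CENSUS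
ba907189b20ed180 §2 «Bad places», W0₃ CONVENTIONS 2fdd2f7063acaab9 §3∕§4 (iii)); dealer K2E1-plan (g5).  Prover seat `hodgecm-mathlib-K2E1-p09` (g6).  THEOREMS ONLY (no `def`,
no `instance`, no notation, no named-fact hypothesis, no `sorry`; default heartbeats); lane `--supports stmt-HodgeConjecture-24833 --as helper` (count-neutral).  Closes no socket.

CURRENCY (generic-local LETTERS, so that every transport currency can instantiate it): two non-archimedean local fields `F` (`= L⁺_v`, centre variable `t`, Haar `ν`) and `E`
(`= L_w`, the unique place over a non-split `v`; abelian variable `X`, Haar `μ`, character `ψ` of conductor exponent `m`); a ring map `ι : F →+* E` (`= ι_w`), continuous, with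
`‖ι t‖_E = ‖t‖_F^d`, `d ≠ 0` (★ `normAbs_adicCompletionSemialgHom`: `d = e_w f_w = 2`); `δ ∈ E`, `δ ≠ 0` (the trace-zero generator, `θ(t) = tδ`); and the CORNER MAP `C : E → E`
(`= X ↦ ½·X·σX`, ★ (a2)₃ `K2E1HeightBigCellLineFormulaU3` :321 `z(X, θ t) = θ t − ½X·cX`) through TWO LETTERS: `C 0 = 0` and the NORM COVARIANCE
`‖y‖_E = 1 ⟹ ∃ u ∈ F, ‖u‖_F = 1, C(X·y) = ι(u)·C(X)` (at the instance `u = N_{E∕F}(y) = y·σy`, ★ `quadraticLocalEquiv_mul_conjLocal`, `‖σy‖ = ‖y‖` ★ `normAbs_conjLocal_apply`);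
the base ball enters CONSTANTS-FIRST as the LETTER `ha : ∀ X ∈ 𝔭_E^a, ‖X‖ ≤ 1 ∧ ‖C X‖ < 1`, its existence (`exists_baseBall`, from `‖C X‖ ≤ κ‖X‖²`) a separate lemma.  THE KERNEL
(spelled inline, no `def`):  `h(X, t) := max(1, ‖X‖_E, ‖ι(t)·δ − C(X)‖_E)` — the finite height factor `max(1, ‖X_w‖, ‖z(X, θ t)_w‖)` of the flat spherical section along the
Heisenberg chart at the place `w`.

THE MATHEMATICS [Tate1950, §2.5; JacquetLanglands1970, §3; CasselsFrohlichANT1967, Ch. II §10].  All four letters of ★ FILE A-TAIL's HEAD are ULTRAMETRIC ∕ SUBSTITUTION facts: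
(B) BASE BALL: for `‖X‖ ≤ 1`, `‖C X‖ < 1`: if `‖ιtδ‖ ≥ 1` then `‖ιtδ − CX‖ = ‖ιtδ‖` (strict ultrametric) and `h(X,t) = max(1,‖ιtδ‖) = h(0,t)`; if `‖ιtδ‖ < 1` both sides are `1`.
(R) RADIAL SHELLS: for `‖y‖ = 1` with `C(Xy) = ι(u)C(X)`, `‖u‖ = 1`: `ι(t)δ − ι(u)C(X) = ι(u)·(ι(u⁻¹t)δ − C(X))` and `‖ι u‖ = 1`, so `h(Xy, t) = h(X, u⁻¹t)` and the UNIT SUBSTITUTION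
`t ↦ u⁻¹t` (Haar-invariant, ★ `integral_comp_mul_left_of_normAbs_eq_one`) gives `∫ h(Xy,t)^{−z} dν = ∫ h(X,t)^{−z} dν` for EVERY `z`; two points of one shell differ by such a `y`.
(NOT the translation `t ↦ t + N(X)∕(2δ)`: `ι(F)·δ` is the trace-zero line while `C(X)` is `σ`-fixed — they never mix.)
(T) TAIL: once `‖ιtδ‖ > max(‖x_k‖, ‖C x_k‖)` (all `k ≤ n`), `h(x_k, t) = max(1, ‖ιtδ‖) = h(0, t)`; with `‖ιtδ‖ = ‖t‖^d‖δ‖ ≥ ‖t‖·‖δ‖` off `𝒪_F` this holds off a ball `S = 𝔭_F^{−J}`.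
(H) on `S`: `h ≤ max(1, ‖x_k‖, ‖ιtδ‖, ‖Cx_k‖) ≤ H`.  Hence (★ FILE A-TAIL) THE PACKAGE: for `ξ ∈ 𝔭_E^{m−a+n} ∖ 𝔭_E^{m−a+n+1}` there is ONE ENTIRE `W` with
`∫_E (∫_F h(X,t)^{−z} dν) ψ(Xξ) dμ = W(z)` at every `z` where the iterated integrand is `μ`-integrable and the `t`-integrands are `ν`-integrable (the consumer's Euler-product ∕
Tonelli letters on the window `1 < Re z`), and the `S`-factor VANISHES for `ξ ∉ 𝔭_E^{m−a}`.

* §1 pointwise: `one_le_cornerKernel`, `continuous_cornerKernel`, `normAbs_sub_le_max`, `normAbs_sub_eq_of_lt`, **`cornerKernel_eq_base`** (B), **`cornerKernel_eq_tail`** (T),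
  `cornerKernel_le` (H), **`cornerKernel_mul_eq`** ∕ **`integral_cornerKernel_cpow_eq_of_mem_shell`** (R), `exists_mem_shell`, `exists_baseBall`.
* §2 THE PACKAGE: **`exists_entire_eq_integral_integral_cornerKernel`**, **`integral_integral_cornerKernel_eq_zero_of_not_mem`**.
HONEST LABEL: HC_CM is proved only modulo the 7 printed citations (2 remaining named inputs: hLiu418 = `stmt-HodgeConjecture-24832`, h413 = `stmt-HodgeConjecture-24833`) until rung 0
closes; this file asserts no named fact and closes no socket; count-neutral.  NOT HERE: the integrability letters (Tonelli from the global `hΦZi`, or the local anisotropy bound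
`‖ιtδ − CX‖ ≥ ‖2‖·max(‖ιtδ‖, ‖CX‖)`) and the split bad places (two-variable kernel) — separate files if dealt.

## References
* [Tate1950] J. Tate, *Fourier analysis in number fields and Hecke's zeta-functions* (1950), §2.2 Lemma 2.2.5, §2.5.
* [JacquetLanglands1970] H. Jacquet, R. P. Langlands, *Automorphic Forms on GL(2)*, LNM 114 (1970), §3.
* [CasselsFrohlichANT1967] J. W. S. Cassels, A. Fröhlich (eds.), *Algebraic Number Theory* (1967), Ch. II §10 (normalised absolute values in an extension).
-/

set_option autoImplicit false
set_option linter.dupNamespace false  -- the mandated namespace repeats the summit's segment (`HodgeConjecture.HodgeConjecture`)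

noncomputable section

open MeasureTheory Filter Topology Set
open scoped NNReal ENNReal
open Literature.NumberTheory.GaloisRepresentations.IsNonarchimedeanLocalField
open Literature.NumberTheory.Automorphic Literature.NumberTheory.Automorphic.LocalFieldHaar
open Summit.HodgeConjecture.HodgeConjecture.Cruxes.H413.K2E1FiniteWhittakerStepSymbolU3
open Summit.HodgeConjecture.HodgeConjecture.Cruxes.H413.K2E1FiniteWhittakerStepSymbolU3Tail

namespace Summit.HodgeConjecture.HodgeConjecture.Cruxes.H413.K2E1FiniteWhittakerStepSymbolU3Line

variable {F E : Type*} [Field F] [ValuativeRel F] [TopologicalSpace F] [IsNonarchimedeanLocalField F]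
  [Field E] [ValuativeRel E] [TopologicalSpace E] [IsNonarchimedeanLocalField E]

/-! ## §1 Pointwise facts of the corner kernel `h(X,t) = max(1, ‖X‖, ‖ι(t)·δ − C(X)‖)` -/

/-- `‖x − y‖ ≤ max(‖x‖, ‖y‖)` (★ `normAbs_add_le_max`, ★ `normAbs_neg`). [folklore] -/
theorem normAbs_sub_le_max (x y : E) :
    normAbs E (x - y) ≤ max (normAbs E x) (normAbs E y) := by
  have h := normAbs_add_le_max x (-y)
  rwa [normAbs_neg, ← sub_eq_add_neg] at h

/-- `‖x − y‖ = ‖x‖` when `‖y‖ < ‖x‖` (★ `normAbs_add_eq_of_lt`). [folklore] -/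
theorem normAbs_sub_eq_of_lt {x y : E} (h : normAbs E y < normAbs E x) : normAbs E (x - y) = normAbs E x := by
  rw [sub_eq_add_neg]
  exact normAbs_add_eq_of_lt (by rwa [normAbs_neg])

section Pointwise

variable (ι : F →+* E) (δ : E) (C : E → E)

omit [ValuativeRel F] [TopologicalSpace F] [IsNonarchimedeanLocalField F] in
/-- `h ≥ 1`. [folklore] -/
theorem one_le_cornerKernel (X : E) (t : F) : (1 : ℝ) ≤ max 1 (max (normAbs E X : ℝ) (normAbs E (ι t * δ - C X) : ℝ)) := le_max_left _ _

omit [ValuativeRel F] [IsNonarchimedeanLocalField F] in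
/-- `t ↦ h(X, t)` is continuous (for `ι` continuous; ★ `continuous_normAbs`), hence measurable. [folklore] -/
theorem continuous_cornerKernel (hιc : Continuous ι) (X : E) : Continuous fun t : F => max 1 (max (normAbs E X : ℝ) (normAbs E (ι t * δ - C X) : ℝ)) :=
  continuous_const.max (continuous_const.max (NNReal.continuous_coe.comp (continuous_normAbs.comp ((hιc.mul continuous_const).sub continuous_const))))

omit [ValuativeRel F] [TopologicalSpace F] [IsNonarchimedeanLocalField F] in
/-- **(B) THE BASE BALL, pointwise**: if `C 0 = 0`, `‖X‖ ≤ 1` and `‖C X‖ < 1` then `h(X, t) = h(0, t)` for every `t` (`‖ιtδ‖ ≥ 1`: strict ultrametric; `‖ιtδ‖ < 1`: both are `1`).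
[cite: Tate1950, §2.5] -/
theorem cornerKernel_eq_base (hC0 : C 0 = 0) {X : E} (hX : normAbs E X ≤ 1) (hCX : normAbs E (C X) < 1) (t : F) :
    max 1 (max (normAbs E X : ℝ) (normAbs E (ι t * δ - C X) : ℝ)) = max 1 (max (normAbs E (0 : E) : ℝ) (normAbs E (ι t * δ - C 0) : ℝ)) := by
  rw [hC0, sub_zero, map_zero, NNReal.coe_zero]
  rcases le_or_gt 1 (normAbs E (ι t * δ)) with h1 | h1
  · rw [normAbs_sub_eq_of_lt (hCX.trans_le h1)]
    have hX' : (normAbs E X : ℝ) ≤ normAbs E (ι t * δ) := by exact_mod_cast hX.trans h1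
    rw [max_eq_right hX', max_eq_right (NNReal.coe_nonneg _)]
  · have hlt : normAbs E (ι t * δ - C X) < 1 := (normAbs_sub_le_max _ _).trans_lt (max_lt h1 hCX)
    have hA : max (normAbs E X : ℝ) (normAbs E (ι t * δ - C X) : ℝ) ≤ 1 := max_le (by exact_mod_cast hX) (by exact_mod_cast hlt.le)
    have hB : max (0 : ℝ) (normAbs E (ι t * δ) : ℝ) ≤ 1 := max_le zero_le_one (by exact_mod_cast h1.le)
    rw [max_eq_left hA, max_eq_left hB]

omit [ValuativeRel F] [TopologicalSpace F] [IsNonarchimedeanLocalField F] in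
/-- **(T) THE TAIL, pointwise**: if `C 0 = 0`, `‖X‖ ≤ ‖ιtδ‖` and `‖C X‖ < ‖ιtδ‖` then `h(X, t) = max(1, ‖ιtδ‖) = h(0, t)`. [cite: Tate1950, §2.5] -/
theorem cornerKernel_eq_tail (hC0 : C 0 = 0) {X : E} {t : F} (hX : normAbs E X ≤ normAbs E (ι t * δ)) (hCX : normAbs E (C X) < normAbs E (ι t * δ)) :
    max 1 (max (normAbs E X : ℝ) (normAbs E (ι t * δ - C X) : ℝ)) = max 1 (max (normAbs E (0 : E) : ℝ) (normAbs E (ι t * δ - C 0) : ℝ)) := by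
  rw [hC0, sub_zero, map_zero, NNReal.coe_zero, normAbs_sub_eq_of_lt hCX, max_eq_right (show (normAbs E X : ℝ) ≤ normAbs E (ι t * δ) by exact_mod_cast hX),
    max_eq_right (NNReal.coe_nonneg _)]

omit [ValuativeRel F] [TopologicalSpace F] [IsNonarchimedeanLocalField F] in
/-- **(H) THE BOUND, pointwise**: `h(X, t) ≤ max(1, ‖X‖, ‖ιtδ‖, ‖C X‖)` (ultrametric). [folklore] -/
theorem cornerKernel_le (X : E) (t : F) :
    max 1 (max (normAbs E X : ℝ) (normAbs E (ι t * δ - C X) : ℝ)) ≤ max 1 (max (normAbs E X : ℝ) (max (normAbs E (ι t * δ) : ℝ) (normAbs E (C X) : ℝ))) :=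
  max_le_max le_rfl (max_le_max le_rfl (by exact_mod_cast normAbs_sub_le_max (ι t * δ) (C X)))

omit [ValuativeRel F] [TopologicalSpace F] [IsNonarchimedeanLocalField F] in
/-- **(R) RADIALITY, pointwise**: if `‖ι u‖ = 1`, `‖y‖ = 1`, `u ≠ 0` and `C(X·y) = ι(u)·C(X)`, then `h(X·y, t) = h(X, u⁻¹·t)` (`ι(t)δ − ι(u)C(X) = ι(u)·(ι(u⁻¹t)δ − C(X))`).
[cite: CasselsFrohlichANT1967, Ch. II §10] -/
theorem cornerKernel_mul_eq {u : F} (hιu : normAbs E (ι u) = 1) (hu0 : u ≠ 0) {X y : E} (hy : normAbs E y = 1) (hCy : C (X * y) = ι u * C X) (t : F) :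
    max 1 (max (normAbs E (X * y) : ℝ) (normAbs E (ι t * δ - C (X * y)) : ℝ)) = max 1 (max (normAbs E X : ℝ) (normAbs E (ι (u⁻¹ * t) * δ - C X) : ℝ)) := by
  have h1 : normAbs E (X * y) = normAbs E X := by rw [map_mul, hy, mul_one]
  have h2 : ι t * δ - C (X * y) = ι u * (ι (u⁻¹ * t) * δ - C X) := by
    rw [hCy, mul_sub, ← mul_assoc, ← map_mul, mul_inv_cancel_left₀ hu0]
  rw [h1, h2, map_mul, hιu, one_mul]

variable [MeasurableSpace F] [BorelSpace F] (ν : Measure F) [ν.IsAddHaarMeasure]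

/-- **(R) RADIALITY OF THE `t`-INTEGRAL under a unit twist**: with `‖u‖_F = 1 ⟹ ‖ι u‖_E = 1`, for `‖y‖ = 1`, `‖u‖ = 1`, `C(X·y) = ι(u)·C(X)` and EVERY `z`,
`∫ h(X·y, t)^{−z} dν = ∫ h(X, t)^{−z} dν` (the unit substitution `t ↦ u⁻¹t`, ★ `integral_comp_mul_left_of_normAbs_eq_one`). [cite: Tate1950, §2.2 Lemma 2.2.5] -/
theorem integral_cornerKernel_cpow_mul_eq (hι1 : ∀ u : F, normAbs F u = 1 → normAbs E (ι u) = 1) {X y : E} (hy : normAbs E y = 1) {u : F} (hu : normAbs F u = 1)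
    (hCy : C (X * y) = ι u * C X) (z : ℂ) :
    ∫ t, ((max 1 (max (normAbs E (X * y) : ℝ) (normAbs E (ι t * δ - C (X * y)) : ℝ)) : ℝ) : ℂ) ^ (-z) ∂ν =
      ∫ t, ((max 1 (max (normAbs E X : ℝ) (normAbs E (ι t * δ - C X) : ℝ)) : ℝ) : ℂ) ^ (-z) ∂ν := by
  have hu0 : u ≠ 0 := fun h => by rw [h, map_zero] at hu; exact zero_ne_one hu
  have hu' : normAbs F u⁻¹ = 1 := by rw [map_inv₀, hu, inv_one]
  simp_rw [cornerKernel_mul_eq ι δ C (hι1 u hu) hu0 hy hCy]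
  exact integral_comp_mul_left_of_normAbs_eq_one ν (fun t => ((max 1 (max (normAbs E X : ℝ) (normAbs E (ι t * δ - C X) : ℝ)) : ℝ) : ℂ) ^ (-z)) hu'

/-- **(R) RADIAL SHELLS**: under the norm-covariance letter `‖y‖ = 1 ⟹ ∃ u, ‖u‖ = 1 ∧ C(X·y) = ι(u)·C(X)`, two points `x, X` of ONE shell `𝔭^j ∖ 𝔭^{j+1}` have the same
`t`-integral `∫ h(·, t)^{−z} dν` for every `z` (`X = x·(X∕x)`, `‖X∕x‖ = 1`, ★ `mem_shell_iff`). [cite: Tate1950, §2.5] [cite: CasselsFrohlichANT1967, Ch. II §10] -/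
theorem integral_cornerKernel_cpow_eq_of_mem_shell (hι1 : ∀ u : F, normAbs F u = 1 → normAbs E (ι u) = 1)
    (hC : ∀ X y : E, normAbs E y = 1 → ∃ u : F, normAbs F u = 1 ∧ C (X * y) = ι u * C X) {j : ℤ} {x X : E}
    (hx : x ∈ primePowBall E j \ primePowBall E (j + 1)) (hX : X ∈ primePowBall E j \ primePowBall E (j + 1)) (z : ℂ) :
    ∫ t, ((max 1 (max (normAbs E X : ℝ) (normAbs E (ι t * δ - C X) : ℝ)) : ℝ) : ℂ) ^ (-z) ∂ν =
      ∫ t, ((max 1 (max (normAbs E x : ℝ) (normAbs E (ι t * δ - C x) : ℝ)) : ℝ) : ℂ) ^ (-z) ∂ν := by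
  have hx0 : x ≠ 0 := ne_zero_of_mem_shell hx
  have hxn : normAbs E x ≠ 0 := (map_ne_zero _).2 hx0
  have hy : normAbs E (X / x) = 1 := by rw [map_div₀, mem_shell_iff.1 hX, mem_shell_iff.1 hx, div_self (mem_shell_iff.1 hx ▸ hxn)]
  obtain ⟨u, hu, hCy⟩ := hC x (X / x) hy
  have hXeq : X = x * (X / x) := by rw [mul_div_cancel₀ X hx0]
  rw [hXeq]
  exact integral_cornerKernel_cpow_mul_eq ι δ C ν hι1 hy hu hCy z

end Pointwise

/-- **Every shell is inhabited** (★ `exists_normAbs_eq_inv_zpow_of_int`, ★ `mem_shell_iff`). [folklore] -/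
theorem exists_mem_shell (j : ℤ) : ∃ x : E, x ∈ primePowBall E j \ primePowBall E (j + 1) := by
  obtain ⟨x, -, hx⟩ := exists_normAbs_eq_inv_zpow_of_int (F := E) j
  exact ⟨x, mem_shell_iff.2 hx⟩

/-- **THE BASE BALL EXISTS** (CONSTANTS-FIRST companion of the letter `ha`): if `‖C X‖ ≤ κ·‖X‖²` (at the instance `κ = ‖½‖`, `‖σX‖ = ‖X‖`), then for some `a` every `X ∈ 𝔭^a` has
`‖X‖ ≤ 1` and `‖C X‖ < 1` (`a = N` with `κ·q^{−N} < 1`, ★ `inv_residueFieldCard_lt_one`). [cite: CasselsFrohlichANT1967, Ch. II §10] -/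
theorem exists_baseBall {C : E → E} {κ : ℝ≥0} (hCb : ∀ X, normAbs E (C X) ≤ κ * normAbs E X ^ 2) :
    ∃ a : ℤ, ∀ X ∈ primePowBall E a, normAbs E X ≤ 1 ∧ normAbs E (C X) < 1 := by
  have hq : (residueFieldCard E : ℝ≥0)⁻¹ < 1 := inv_residueFieldCard_lt_one
  have hκ : (0 : ℝ≥0) < (κ + 1)⁻¹ := inv_pos.2 (add_pos_of_nonneg_of_pos zero_le one_pos)
  obtain ⟨N, hN⟩ := exists_pow_lt_of_lt_one hκ hq
  refine ⟨N, fun X hX => ?_⟩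
  rw [mem_primePowBall_iff, zpow_natCast] at hX
  have hq1 : (residueFieldCard E : ℝ≥0)⁻¹ ^ N ≤ 1 := pow_le_one₀ zero_le hq.le
  refine ⟨hX.trans hq1, (hCb X).trans_lt ?_⟩
  have hsq : normAbs E X ^ 2 ≤ (residueFieldCard E : ℝ≥0)⁻¹ ^ N := by
    calc normAbs E X ^ 2 ≤ ((residueFieldCard E : ℝ≥0)⁻¹ ^ N) ^ 2 := pow_le_pow_left₀ zero_le hX 2
      _ ≤ (residueFieldCard E : ℝ≥0)⁻¹ ^ N := pow_le_of_le_one zero_le hq1 two_ne_zero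
  calc κ * normAbs E X ^ 2 ≤ κ * (residueFieldCard E : ℝ≥0)⁻¹ ^ N := mul_le_mul_of_nonneg_left hsq zero_le
    _ ≤ κ * (κ + 1)⁻¹ := mul_le_mul_of_nonneg_left hN.le zero_le
    _ < 1 := by
        rw [← div_eq_mul_inv, div_lt_one (add_pos_of_nonneg_of_pos zero_le one_pos)]
        exact lt_add_one κ

/-! ## §2 The package: the Whittaker `S`-factor of the corner kernel is one entire function, supported on `ξ ∈ 𝔭^{m−a}` -/

section Package

variable [MeasurableSpace F] [BorelSpace F] (ν : Measure F) [ν.IsAddHaarMeasure] [MeasurableSpace E] [BorelSpace E] (μ : Measure E) [μ.IsAddHaarMeasure]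

/-- **«W2₃-fin-S» AT A NON-SPLIT BAD PLACE — THE `S`-FACTOR OF THE CORNER KERNEL IS ONE ENTIRE FUNCTION.**  Letters: `ι : F →+* E` continuous with `‖ι t‖ = ‖t‖^d` (`d ≠ 0`),
`δ ≠ 0`, the corner map `C` with `C 0 = 0` and the norm covariance `‖y‖ = 1 ⟹ ∃ u, ‖u‖ = 1 ∧ C(Xy) = ι(u)C(X)`, the base ball `ha`, `ψ` continuous of conductor exponent `m`,
`ξ ∈ 𝔭^{m−a+n} ∖ 𝔭^{m−a+n+1}`.  Then `∃ W : ℂ → ℂ` ENTIRE such that for EVERY `z` at which the iterated integrand is `μ`-integrable and the `t`-integrands are `ν`-integrable,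
`∫_E (∫_F max(1, ‖X‖, ‖ι(t)δ − C X‖)^{−z} dν(t)) ψ(Xξ) dμ(X) = W(z)` — ★ FILE A-TAIL's HEAD with (B)(R)(T)(H) discharged by §1 (shell representatives by ★ `exists_mem_shell`, the tail
ball `S = 𝔭_F^{−J}` with `q^J‖δ‖ > max_{k≤n}(‖x_k‖ + ‖C x_k‖)`). [cite: Tate1950, §2.5] [cite: JacquetLanglands1970, §3] [cite: CasselsFrohlichANT1967, Ch. II §10] -/
theorem exists_entire_eq_integral_integral_cornerKernel (ι : F →+* E) (hιc : Continuous ι) {d : ℕ} (hd : d ≠ 0) (hιd : ∀ t, normAbs E (ι t) = normAbs F t ^ d)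
    {δ : E} (hδ : δ ≠ 0) (C : E → E) (hC0 : C 0 = 0) (hC : ∀ X y : E, normAbs E y = 1 → ∃ u : F, normAbs F u = 1 ∧ C (X * y) = ι u * C X)
    {a : ℤ} (ha : ∀ X ∈ primePowBall E a, normAbs E X ≤ 1 ∧ normAbs E (C X) < 1)
    {ψ : AddChar E Circle} (hψ : Continuous ψ) {m : ℤ} (hm : ψ.HasConductorExp m) {ξ : E} {n : ℕ} (hn : ξ ∈ primePowBall E (m - a + n))
    (hn' : ξ ∉ primePowBall E (m - a + n + 1)) :
    ∃ W : ℂ → ℂ, Differentiable ℂ W ∧ ∀ z : ℂ,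
      Integrable (fun X : E => (∫ t, ((max 1 (max (normAbs E X : ℝ) (normAbs E (ι t * δ - C X) : ℝ)) : ℝ) : ℂ) ^ (-z) ∂ν) * ((ψ (X * ξ) : Circle) : ℂ)) μ →
      (∀ X : E, Integrable (fun t : F => ((max 1 (max (normAbs E X : ℝ) (normAbs E (ι t * δ - C X) : ℝ)) : ℝ) : ℂ) ^ (-z)) ν) →
        ∫ X, (∫ t, ((max 1 (max (normAbs E X : ℝ) (normAbs E (ι t * δ - C X) : ℝ)) : ℝ) : ℂ) ^ (-z) ∂ν) * ((ψ (X * ξ) : Circle) : ℂ) ∂μ = W z := by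
  have hι1 : ∀ u : F, normAbs F u = 1 → normAbs E (ι u) = 1 := fun u hu => by rw [hιd, hu, one_pow]
  -- shell representatives `x k ∈ 𝔭^{a−k−1} ∖ 𝔭^{a−k}`
  have hrep : ∀ k : ℕ, ∃ x : E, x ∈ primePowBall E (a - ((k : ℤ) + 1)) \ primePowBall E (a - (k : ℤ)) := fun k => by
    obtain ⟨x, hx⟩ := exists_mem_shell (E := E) (a - ((k : ℤ) + 1))
    exact ⟨x, by rwa [show a - ((k : ℤ) + 1) + 1 = a - (k : ℤ) by ring] at hx⟩
  choose x hx using hrep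
  -- (R)
  have hR : ∀ k : ℕ, ∀ X ∈ primePowBall E (a - ((k : ℤ) + 1)) \ primePowBall E (a - (k : ℤ)), ∀ z : ℂ,
      ∫ t, ((max 1 (max (normAbs E X : ℝ) (normAbs E (ι t * δ - C X) : ℝ)) : ℝ) : ℂ) ^ (-z) ∂ν =
        ∫ t, ((max 1 (max (normAbs E (x k) : ℝ) (normAbs E (ι t * δ - C (x k)) : ℝ)) : ℝ) : ℂ) ^ (-z) ∂ν := by
    intro k X hX z
    have hx' : x k ∈ primePowBall E (a - ((k : ℤ) + 1)) \ primePowBall E (a - ((k : ℤ) + 1) + 1) := by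
      rw [show a - ((k : ℤ) + 1) + 1 = a - (k : ℤ) by ring]; exact hx k
    have hX' : X ∈ primePowBall E (a - ((k : ℤ) + 1)) \ primePowBall E (a - ((k : ℤ) + 1) + 1) := by
      rw [show a - ((k : ℤ) + 1) + 1 = a - (k : ℤ) by ring]; exact hX
    exact integral_cornerKernel_cpow_eq_of_mem_shell ι δ C ν hι1 hC hx' hX' z
  -- (B)
  have hB : ∀ X ∈ primePowBall E a, ∀ t : F, max 1 (max (normAbs E X : ℝ) (normAbs E (ι t * δ - C X) : ℝ)) =
      max 1 (max (normAbs E (0 : E) : ℝ) (normAbs E (ι t * δ - C 0) : ℝ)) := fun X hX t => cornerKernel_eq_base ι δ C hC0 (ha X hX).1 (ha X hX).2 t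
  -- the tail ball `S = 𝔭_F^{−J}` with `q^J·‖δ‖ > M := Σ_{k≤n} (‖x_k‖ + ‖C x_k‖)`
  set M : ℝ≥0 := ∑ k ∈ Finset.range (n + 1), (normAbs E (x k) + normAbs E (C (x k))) with hM
  have hMk : ∀ k ≤ n, normAbs E (x k) ≤ M ∧ normAbs E (C (x k)) ≤ M := fun k hk => by
    have h := Finset.single_le_sum (f := fun k => normAbs E (x k) + normAbs E (C (x k))) (fun _ _ => zero_le) (Finset.mem_range.2 (Nat.lt_succ_of_le hk))
    exact ⟨le_self_add.trans h, le_add_self.trans h⟩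
  have hδ0 : 0 < normAbs E δ := pos_iff_ne_zero.2 ((map_ne_zero _).2 hδ)
  have hq1 : (1 : ℝ≥0) < (residueFieldCard F : ℝ≥0) := by exact_mod_cast one_lt_residueFieldCard F
  obtain ⟨J, hJ⟩ := pow_unbounded_of_one_lt (M / normAbs E δ) hq1
  -- off `S`: `‖ι t δ‖ > M`
  have htail : ∀ t : F, t ∉ primePowBall F (-(J : ℤ)) → (M : ℝ≥0) < normAbs E (ι t * δ) := by
    intro t ht
    rw [mem_primePowBall_iff, not_le, zpow_neg, zpow_natCast, inv_pow, inv_inv] at ht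
    have ht1 : 1 ≤ normAbs F t := (one_le_pow₀ hq1.le).trans ht.le
    have hpow : normAbs F t ≤ normAbs F t ^ d := le_self_pow₀ ht1 hd
    rw [map_mul, hιd]
    calc M = M / normAbs E δ * normAbs E δ := (div_mul_cancel₀ M hδ0.ne').symm
      _ < (residueFieldCard F : ℝ≥0) ^ J * normAbs E δ := mul_lt_mul_of_pos_right hJ hδ0
      _ ≤ normAbs F t ^ d * normAbs E δ := mul_le_mul_of_nonneg_right (ht.le.trans hpow) zero_le
  -- (T)
  have hT : ∀ k ≤ n, ∀ t ∉ primePowBall F (-(J : ℤ)), max 1 (max (normAbs E (x k) : ℝ) (normAbs E (ι t * δ - C (x k)) : ℝ)) =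
      max 1 (max (normAbs E (0 : E) : ℝ) (normAbs E (ι t * δ - C 0) : ℝ)) := fun k hk t ht =>
    cornerKernel_eq_tail ι δ C hC0 ((hMk k hk).1.trans (htail t ht).le) ((hMk k hk).2.trans_lt (htail t ht))
  -- (H) on `S`: `‖ι t δ‖ ≤ (q^J)^d ‖δ‖`
  have hS : ∀ t ∈ primePowBall F (-(J : ℤ)), normAbs E (ι t * δ) ≤ ((residueFieldCard F : ℝ≥0) ^ J) ^ d * normAbs E δ := by
    intro t ht
    rw [mem_primePowBall_iff, zpow_neg, zpow_natCast, inv_pow, inv_inv] at ht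
    rw [map_mul, hιd]
    exact mul_le_mul_of_nonneg_right (pow_le_pow_left₀ zero_le ht d) zero_le
  have hH : ∀ k ≤ n, ∀ t ∈ primePowBall F (-(J : ℤ)), max 1 (max (normAbs E (x k) : ℝ) (normAbs E (ι t * δ - C (x k)) : ℝ)) ≤
      max 1 (max (M : ℝ) (max ((((residueFieldCard F : ℝ≥0) ^ J) ^ d * normAbs E δ : ℝ≥0) : ℝ) (M : ℝ))) := fun k hk t ht =>
    (cornerKernel_le ι δ C (x k) t).trans (max_le_max le_rfl (max_le_max (by exact_mod_cast (hMk k hk).1)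
      (max_le_max (by exact_mod_cast hS t ht) (by exact_mod_cast (hMk k hk).2))))
  have hH0 : ∀ t ∈ primePowBall F (-(J : ℤ)), max 1 (max (normAbs E (0 : E) : ℝ) (normAbs E (ι t * δ - C 0) : ℝ)) ≤
      max 1 (max (M : ℝ) (max ((((residueFieldCard F : ℝ≥0) ^ J) ^ d * normAbs E δ : ℝ≥0) : ℝ) (M : ℝ))) := fun t ht =>
    (cornerKernel_le ι δ C 0 t).trans (max_le_max le_rfl (max_le_max (by rw [map_zero]; exact_mod_cast (zero_le : (0 : ℝ≥0) ≤ M))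
      (max_le_max (by exact_mod_cast hS t ht) (by rw [hC0, map_zero]; exact_mod_cast (zero_le : (0 : ℝ≥0) ≤ M)))))
  obtain ⟨W, hW, hWeq⟩ := exists_entire_eq_integral_integral_cpow_neg_mul_addChar μ ν
    (h := fun (X : E) (t : F) => max 1 (max (normAbs E X : ℝ) (normAbs E (ι t * δ - C X) : ℝ)))
    (fun X => (continuous_cornerKernel ι δ C hιc X).measurable) (one_le_cornerKernel ι δ C) hB hR hψ hm hn hn'
    (measurableSet_primePowBall _) (isCompact_primePowBall _).measure_ne_top hT hH hH0
  exact ⟨W, hW, fun z hint hintt => hWeq z hint (fun k _ => hintt (x k)) (hintt 0)⟩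

/-- **THE SUPPORT OF THE `S`-FACTOR**: under the same letters (no integrability of the `t`-slices needed), `∫_E (∫_F h(X,t)^{−z} dν) ψ(Xξ) dμ = 0` for `ξ ∉ 𝔭_E^{m−a}` whenever the
iterated integrand is integrable — the Whittaker `S`-factor at a bad place is supported on the fractional ideal `𝔭_E^{m−a}` (the `Cf`-box of W4₃ via ★ `K2E1FractionalIdealAdelicSupport`).
[cite: Tate1950, §2.5] -/
theorem integral_integral_cornerKernel_eq_zero_of_not_mem (ι : F →+* E) (hι1 : ∀ u : F, normAbs F u = 1 → normAbs E (ι u) = 1) (δ : E) (C : E → E) (hC0 : C 0 = 0)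
    (hC : ∀ X y : E, normAbs E y = 1 → ∃ u : F, normAbs F u = 1 ∧ C (X * y) = ι u * C X)
    {a : ℤ} (ha : ∀ X ∈ primePowBall E a, normAbs E X ≤ 1 ∧ normAbs E (C X) < 1)
    {ψ : AddChar E Circle} (hψ : Continuous ψ) {m : ℤ} (hm : ψ.HasConductorExp m) {ξ : E} (hξ : ξ ∉ primePowBall E (m - a)) {z : ℂ}
    (hint : Integrable (fun X : E => (∫ t, ((max 1 (max (normAbs E X : ℝ) (normAbs E (ι t * δ - C X) : ℝ)) : ℝ) : ℂ) ^ (-z) ∂ν) * ((ψ (X * ξ) : Circle) : ℂ)) μ) :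
    ∫ X, (∫ t, ((max 1 (max (normAbs E X : ℝ) (normAbs E (ι t * δ - C X) : ℝ)) : ℝ) : ℂ) ^ (-z) ∂ν) * ((ψ (X * ξ) : Circle) : ℂ) ∂μ = 0 := by
  have hrep : ∀ k : ℕ, ∃ x : E, x ∈ primePowBall E (a - ((k : ℤ) + 1)) \ primePowBall E (a - (k : ℤ)) := fun k => by
    obtain ⟨x, hx⟩ := exists_mem_shell (E := E) (a - ((k : ℤ) + 1))
    exact ⟨x, by rwa [show a - ((k : ℤ) + 1) + 1 = a - (k : ℤ) by ring] at hx⟩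
  choose x hx using hrep
  refine integral_integral_cpow_neg_mul_addChar_eq_zero_of_not_mem μ ν
    (h := fun (X : E) (t : F) => max 1 (max (normAbs E X : ℝ) (normAbs E (ι t * δ - C X) : ℝ))) (x := x)
    (fun X hX t => cornerKernel_eq_base ι δ C hC0 (ha X hX).1 (ha X hX).2 t) (fun k X hX => ?_) hψ hm hξ hint
  have hx' : x k ∈ primePowBall E (a - ((k : ℤ) + 1)) \ primePowBall E (a - ((k : ℤ) + 1) + 1) := by
    rw [show a - ((k : ℤ) + 1) + 1 = a - (k : ℤ) by ring]; exact hx k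
  have hX' : X ∈ primePowBall E (a - ((k : ℤ) + 1)) \ primePowBall E (a - ((k : ℤ) + 1) + 1) := by
    rw [show a - ((k : ℤ) + 1) + 1 = a - (k : ℤ) by ring]; exact hX
  exact integral_cornerKernel_cpow_eq_of_mem_shell ι δ C ν hι1 hC hx' hX' z

end Package

end Summit.HodgeConjecture.HodgeConjecture.Cruxes.H413.K2E1FiniteWhittakerStepSymbolU3Line

end
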